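import Literature.Algebra.Polynomial.ZeroOneVanishingIdeal
import Literature.Computability.Complexity.Mod2PerfectMatchings
import HarnessLib

/-!
# `⟨𝒫_n⟩` is the vanishing ideal of the perfect matchings of `K_n` (BBCHPRRWZ 2017, §4.2)

Braun–Brown-Cohen–Huq–Pokutta–Raghavendra–Roy–Weitz–Zink, *The matching problem has no small
symmetric SDP*, Math. Program. 165 (2017), §4.2: "the ring of real-valued functions on perfect
matchings is isomorphic to `ℝ[x]/⟨𝒫_n⟩`", i.e. the ideal of the matching constraints is the
vanishing ideal of the set of perfect matchings `χ^M` (`Mod2PerfectMatchings.lean`):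

* `eval_edgeIndicator_eq_zero_of_mem_span` — elements of `⟨𝒫_n⟩` vanish on every perfect matching;
* `matchingVanishingIdeal` — **a polynomial vanishing on all perfect matchings lies in `⟨𝒫_n⟩`**
  (the cell's typed target `MatchingVanishingIdeal`, HOME/pnp-psdrank-p2/TARGET.md, Rung 2 SOS
  column), from the Boolean vanishing-ideal lemma
  `ZeroOneVanishingIdeal.mem_span_of_forall_eval_eq_zero` and `Mod2.exists_isPMOn_of_common_zero`;
* `mem_span_iff` — both directions.

## References

* G. Braun et al., *The matching problem has no small symmetric SDP*, Math. Program. 165 (2017)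
  643–662, §4.2 (arXiv:1504.00703, p. 7). [BraunEtAl2016]
-/

noncomputable section

open MvPolynomial Finset
open Literature.Barriers.PneNP (IsPMOn)
open Literature.Algebra.Polynomial.ZeroOneVanishingIdeal (mem_span_of_forall_eval_eq_zero)

namespace Literature.Computability.Complexity

variable {n : ℕ}

/-- Elements of `⟨𝒫_n⟩` vanish on every perfect matching. [cite: BraunEtAl2016, §4.2 (p. 7)] -/
theorem eval_edgeIndicator_eq_zero_of_mem_span {F : MvPolynomial (KnEdge n) ℝ}
    (hF : F ∈ Ideal.span (Set.range (Mod2.system n))) {M : Finset (Sym2 (Fin n))}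
    (hM : IsPMOn univ M) : eval (edgeIndicator M) F = 0 := by
  refine Submodule.span_induction (p := fun F _ => eval (edgeIndicator M) F = 0) ?_ ?_ ?_ ?_ hF
  · rintro _ ⟨ι, rfl⟩
    exact Mod2.eval_system_edgeIndicator hM ι
  · exact map_zero _
  · intro _ _ _ _ h1 h2
    rw [map_add, h1, h2, add_zero]
  · intro a _ _ h
    rw [smul_eq_mul, map_mul, h, mul_zero]

/-- **`⟨𝒫_n⟩` is the vanishing ideal of the perfect matchings** (the cell's `MatchingVanishingIdeal`):
a polynomial in the edge variables of `K_n` that vanishes at `χ^M` for every perfect matching `M`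
lies in the ideal generated by the matching constraints. [cite: BraunEtAl2016, §4.2 (p. 7, "the ring of functions on perfect matchings is ℝ[x]/⟨𝒫_n⟩")] -/
theorem matchingVanishingIdeal (n : ℕ) (F : MvPolynomial (KnEdge n) ℝ)
    (hF : ∀ M : Finset (Sym2 (Fin n)), IsPMOn univ M → eval (edgeIndicator M) F = 0) :
    F ∈ Ideal.span (Set.range (Mod2.system n)) := by
  refine mem_span_of_forall_eval_eq_zero (Mod2.system n)
    (fun e => Ideal.subset_span ⟨Sum.inl e, rfl⟩) F fun x _ hx => ?_
  obtain ⟨M, hM, rfl⟩ := Mod2.exists_isPMOn_of_common_zero hx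
  exact hF M hM

/-- `F ∈ ⟨𝒫_n⟩ ↔ F` vanishes on all perfect matchings of `K_n`. [cite: BraunEtAl2016, §4.2 (p. 7)] -/
theorem mem_span_iff (F : MvPolynomial (KnEdge n) ℝ) :
    F ∈ Ideal.span (Set.range (Mod2.system n)) ↔
      ∀ M : Finset (Sym2 (Fin n)), IsPMOn univ M → eval (edgeIndicator M) F = 0 :=
  ⟨fun h _ hM => eval_edgeIndicator_eq_zero_of_mem_span h hM, matchingVanishingIdeal n F⟩

end Literature.Computability.Complexity
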